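import Summits.ABC.IUTFork.Joshi.ThetaLociPadicLog
import Summits.ABC.IUTFork.Joshi.LogVolumesHullsScaling
import Literature.AnabelianGeometry.AbsoluteAnabelian.LogShellsOfUnitLog
import Literature.IUT.LogVolume.LogSeriesEstimates
import HarnessLib

/-!
# Joshi, *Arithmetic Teichmüller Spaces III* (arXiv:2401.13508v4) Lemma 9.8.2.7 — DISCHARGED for EVERY `p`-adic
# field; Remark 9.8.2.3 and (9.9.2)–(9.9.3) DERIVED; E-t23's input `NormLogBK` SUPPLIED

Proof-only companion of `Joshi/ThetaLociSizes.lean` (p429205) and sequel of `Joshi/ThetaLociPadicLog.lean` (p430076)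
(abc-iut cell, branch E, rung LADDER-ABC:A2.E; seat abc-iut-E-t22, slot T-22, generation 2). Lemma 9.8.2.7 (p.117
l.159–161 of the render `HOME/lit/renders/Joshi-arxiv-2401.13508/`): «Let `E` be a p-adic field and let `|−|_E` be a
p-adic absolute value on `E`. Then for all `x ∈ (p*·𝒪_E) − {0}` one has `|log_E(1+x)|_E = |x|_E`» (`p* = p` for
odd `p`, `4` for `p = 2`, (9.6.1.2) p.108 — abc-iut-E-t21's `ATS3.pStar`); printed proof p.118 – p.119 l.22 after
[Koblitz 1984, IV.1] (`|xⁿ/n| < |x|` for `n ≥ 2`). `ThetaLociSizes` TYPED it as the predicate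
`ATS3.LogOnePlusNormEq E logE p*`; `ThetaLociPadicLog` PROVED it for `E = ℚ_p` only and left «TODO(general form)».

HERE IT IS PROVED AS PRINTED, for every `p`-adic field: every nontrivially normed field `E` which is a normed
`ℚ_p`-algebra (`‖p‖ = p⁻¹`), ultrametric and complete — every finite extension `L′_w/ℚ_{p_w}`, ramified or not — and
for `log_E` = the tree's logarithmic series `Literature.IUT.LogVolume.logSeries` (abc-iut-S1, `LocalUnitLog.lean`,
Neukirch II (5.4)), = its `unitLog` (`log_E : 𝒪_E^× → E`, Neukirch II (5.5); the `log` of the standard model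
`PadicLogOnUnits.ofUnitLog p E` of [AbsTopIII] Def. 5.4 (iii), abc-iut-L3-t11, which abc-iut-E-t21's
`ATS3.LocalBKDatum` extends), and = ANY branch agreeing with the series on `1 + p*·𝒪_E`. TOOL: the tree's contraction
estimate `norm_logSeries_add_le` (abc-iut-S1 `LogSeriesEstimates.lean`, Koblitz IV §1): `‖L(y) + (1−y)‖ ≤ θ·‖1−y‖` for
`‖1−y‖ ≤ ρ`, `θ = ρ·p^{1/(p−1)}`; at `ρ = ‖p*‖` one has `θ < 1` STRICTLY (`p` odd: `p^{−(p−2)/(p−1)}`; `p = 2`: `2⁻¹` —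
abc-iut-L3-t11's `norm_pstarNat_mul_rpow_lt_one`, «why `p* = 4` for `p = 2`»), so the isosceles principle gives
`‖L(1+x)‖ = ‖x‖` for `x ≠ 0`. This is where ramification bites: in a ramified `E`, `‖x‖ < 1` does NOT give
`‖x‖ ≤ ‖p‖`, and print's hypothesis `x ∈ p*·𝒪_E` is exactly the radius at which the series is an isometry.

DERIVED from it, as print says («by Lemma 9.8.2.7», p.117 l.63–80; p.120 l.106 – p.121 l.36):
* Rmk. 9.8.2.3: `‖log_E(1 + p*)‖ = ‖p*‖` and `‖p*⁻¹·log_E(1 + p*)‖ = 1` — «`log_BK(1+p*)` contributes an element of unit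
  norm» ((9.7.2.2): `log_BK = p*⁻¹·log_p` on `1 + p*𝒪`); at abc-iut-E-t21's datum `ATS3.LocalBKDatum` whose logarithm is
  the standard model and under HIS reading predicate `LogBKPrincipalUnits` ((9.7.2.2)), the Bloch–Kato logarithm of the
  Kummer class of `1 + p*·t` (`‖t‖ ≤ 1`) has norm `‖t‖` (`LocalBKDatum.norm_logBK_one_add_pstar_mul`), `= 1` at `t = 1`.
* (9.9.2)–(9.9.3): `‖p*⁻¹·log_E(1 + p*·q)‖ = ‖q‖` for `‖q‖ ≤ 1` — the norm of `log_BK(ξ_{w,j})`, `ξ = 1 + p*·q^{1/2ℓ}`.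
* SUPPLIER DISCHARGE (pattern T-55) of abc-iut-E-t23's named input `LogVol.ScalingDatum.NormLogBK` (p429684, «(9.9.2)–
  (9.9.3) … By Lemma 9.8.2.7 … INPUT (Lem. 9.8.2.7: seat T-22)»): it HOLDS at every scaling datum whose fields `L′_{w,j}`
  are `p`-adic fields read with their norms and whose exhibited element is READ as (9.7.2.2) prescribes,
  `τ_j = p*⁻¹·log(1 + p*·q^{1/2ℓ}_{w;j})` with `q^{1/2ℓ}_{w;j} ∈ 𝒪` (`ScalingDatum.normLogBK_of_logReading`; the
  integrality follows from HIS `RootScaling e` for any exponent law `e ≥ 0`, `normLogBK_of_logReading_of_rootScaling`).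
  After this file E-t4's spine at `w` (`fundamentalEstimateSup_of_inputs`, `cor91111_of_inputs`) rests on the (9.7.2.2)
  READING of `τ_j` + `RootScaling scalingExponent` + `CrossNorm` + the sign convention: the analytic input is a theorem.
Consistency with p430076: on principal units of `ℚ_p` the tree's Iwasawa `padicLog` IS `unitLog`
(`padicLog_eq_unitLog_of_isPrincipal`), so `logOnePlusNormEq_padic` is the `E = ℚ_p` instance of `logOnePlusNormEq_unitLog`.

Classical and undisputed mathematics (Koblitz GTM 58 IV §1; Neukirch ANT II (5.5)); 0 new definitions; nothing of Joshi's
construction and no clause of [IUTchIII] Cor. 3.12 is asserted; no side taken on any author. Where a docstring carries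
[claim: Joshi2024ATS3, status: disputed] it records that the DISPLAY is Joshi's; the theorem itself is proved.
-/

noncomputable section

open Set Metric

namespace Summit.ABC.IUTFork.Joshi.ATS3

open Literature.IUT.LogVolume Literature.NumberTheory.Transcendental Literature.NumberTheory.EllipticCurves
  Literature.AnabelianGeometry.AbsoluteAnabelian

/-! ## 1. Joshi's `p*` as an element of a `p`-adic field `E` -/

section PStar

variable (p : ℕ) [hp : Fact p.Prime]
variable (E : Type) [NontriviallyNormedField E] [instE : NormedAlgebra ℚ_[p] E]

omit hp instE in
/-- Joshi's `p*` of (9.6.1.2) (abc-iut-E-t21's `ATS3.pStar`: `4` for `p = 2`, else `p`) IS, as an element of `E`,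
[AbsTopIII] Def. 5.4 (iii)'s `p* = p^{2 or 1}` (abc-iut-L3-t11's exponent form; cf. the [IUTchIII] Def. 1.1 (i) twin
`Literature.IUT.LogThetaLattice.pStar_eq_prime_pow` for abc-iut-L6-t3's `pStar`). [folklore] -/
theorem pStar_cast_eq :
    ((Summit.ABC.IUTFork.Joshi.ATS3.pStar p : ℕ) : E) = ((p ^ (if p = 2 then 2 else 1) : ℕ) : E) := by
  congr 1
  by_cases h : p = 2
  · subst h; rw [pStar_two, if_pos rfl]; norm_num
  · rw [pStar_of_ne_two h, if_neg h, pow_one]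

include instE in
/-- `p* ≠ 0` in `E` (characteristic `0`). [folklore] -/
theorem pStar_cast_ne_zero : ((pStar p : ℕ) : E) ≠ 0 := by
  rw [pStar_cast_eq]; exact pstarNat_cast_ne_zero p E

include instE in
/-- `‖p*‖ < 1`: `p*` lies in the maximal ideal of `𝒪_E`. [folklore] -/
theorem norm_pStar_cast_lt_one : ‖((pStar p : ℕ) : E)‖ < 1 := by
  rw [pStar_cast_eq]; exact norm_pstarNat_cast_lt_one p E

include instE in
/-- **The contraction constant at radius `‖p*‖` is `< 1`**: `‖p*‖·p^{1/(p−1)} < 1` (`p` odd: `p^{1/(p−1)−1}`; `p = 2`: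
`2⁻²·2 = 2⁻¹` — Rmk. 9.7.1.2 p.110 l.22–45, the case split behind `p*`). [folklore] -/
theorem norm_pStar_mul_rpow_lt_one : ‖((pStar p : ℕ) : E)‖ * (p : ℝ) ^ (1 / ((p : ℝ) - 1)) < 1 := by
  rw [pStar_cast_eq]; exact norm_pstarNat_mul_rpow_lt_one p E

include instE in
/-- `x ∈ p*·𝒪_E` (`‖x‖ ≤ ‖p*‖`) makes `1 + x` a principal unit: `‖1 − (1 + x)‖ = ‖x‖ < 1`. [folklore] -/
theorem isPrincipal_one_add {x : E} (hxp : ‖x‖ ≤ ‖((pStar p : ℕ) : E)‖) : IsPrincipal (1 + x) := by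
  rw [IsPrincipal, show (1 : E) - (1 + x) = -x by ring, norm_neg]
  exact hxp.trans_lt (norm_pStar_cast_lt_one p E)

end PStar

/-! ## 2. Lemma 9.8.2.7 for every `p`-adic field -/

section Lemma9827

variable (p : ℕ) [hp : Fact p.Prime]
variable (E : Type) [NontriviallyNormedField E] [instE : NormedAlgebra ℚ_[p] E] [instU : IsUltrametricDist E]
  [instC : CompleteSpace E]

include instE in
/-- **Lemma 9.8.2.7 for every `p`-adic field `E`, series form**: for `x ∈ p*·𝒪_E ∖ {0}` (`0 < ‖x‖ ≤ ‖p*‖`),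
`‖L(1 + x)‖ = ‖x‖` for the logarithmic series `L(y) = −Σ_{n≥1} (1−y)ⁿ/n`. Proof: `‖L(1+x) − x‖ ≤ θ·‖x‖ < ‖x‖` with
`θ = ‖p*‖·p^{1/(p−1)} < 1` (the tree's `norm_logSeries_add_le`), then the isosceles principle. (p.117 l.159–161; proof
p.118 – p.119 l.22.) [claim: Joshi2024ATS3, status: disputed] -/
theorem norm_logSeries_one_add {x : E} (hx : x ≠ 0) (hxp : ‖x‖ ≤ ‖((pStar p : ℕ) : E)‖) :
    ‖logSeries (1 + x)‖ = ‖x‖ := by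
  have hθ := norm_pStar_mul_rpow_lt_one p E
  have h1 : (1 : E) - (1 + x) = -x := by ring
  have hy : ‖1 - (1 + x)‖ ≤ ‖((pStar p : ℕ) : E)‖ := by rw [h1, norm_neg]; exact hxp
  have hle := norm_logSeries_add_le p E hθ.le hy
  rw [h1, norm_neg] at hle
  have hlt : ‖logSeries (1 + x) + -x‖ < ‖x‖ := by
    refine hle.trans_lt ?_
    calc ‖((pStar p : ℕ) : E)‖ * (p : ℝ) ^ (1 / ((p : ℝ) - 1)) * ‖x‖ < 1 * ‖x‖ :=
          mul_lt_mul_of_pos_right hθ (norm_pos_iff.mpr hx)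
      _ = ‖x‖ := one_mul _
  have hmax := IsUltrametricDist.norm_add_eq_max_of_norm_ne_norm hlt.ne
  rwa [show logSeries (1 + x) + -x + x = logSeries (1 + x) by ring, max_eq_right hlt.le] at hmax

include instE instU instC in
/-- On `1 + p*·𝒪_E` the logarithm `log_E : 𝒪_E^× → E` (the tree's `unitLog`) IS the series. [folklore] -/
theorem unitLog_one_add_eq_logSeries {x : E} (hxp : ‖x‖ ≤ ‖((pStar p : ℕ) : E)‖) :
    unitLog (1 + x) = logSeries (1 + x) :=
  unitLog_of_isPrincipal p (isPrincipal_one_add p E hxp)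

include instE instU instC in
/-- **Lemma 9.8.2.7 for every `p`-adic field `E`**, for `log_E = log_p : 𝒪_E^× → E` (the tree's `unitLog`, Neukirch II
(5.5)): `‖log_E(1 + x)‖ = ‖x‖` for `x ∈ p*·𝒪_E ∖ {0}`. [claim: Joshi2024ATS3, status: disputed] -/
theorem norm_unitLog_one_add {x : E} (hx : x ≠ 0) (hxp : ‖x‖ ≤ ‖((pStar p : ℕ) : E)‖) :
    ‖unitLog (1 + x)‖ = ‖x‖ := by
  rw [unitLog_one_add_eq_logSeries p E hxp, norm_logSeries_one_add p E hx hxp]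

include instE instU instC in
/-- **Lemma 9.8.2.7 DISCHARGED for every `p`-adic field** in the typed form of `ThetaLociSizes`: the predicate
`ATS3.LogOnePlusNormEq E log_E p*` HOLDS for `log_E` = the logarithmic series. [claim: Joshi2024ATS3, status: disputed] -/
theorem logOnePlusNormEq_logSeries : LogOnePlusNormEq E logSeries ((pStar p : ℕ) : E) :=
  fun _ hx hxp => norm_logSeries_one_add p E hx hxp

include instE instU instC in
/-- **Lemma 9.8.2.7 DISCHARGED for every `p`-adic field**, `log_E = log_p : 𝒪_E^× → E` (`unitLog`). This closes the
«TODO(general form)» of `ThetaLociPadicLog` (p430076). [claim: Joshi2024ATS3, status: disputed] -/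
theorem logOnePlusNormEq_unitLog : LogOnePlusNormEq E unitLog ((pStar p : ℕ) : E) :=
  fun _ hx hxp => norm_unitLog_one_add p E hx hxp

include instE instU instC in
/-- **Lemma 9.8.2.7 for ANY branch of the logarithm**: every `log_E : E → E` agreeing with the series on `1 + p*·𝒪_E`
satisfies `LogOnePlusNormEq E log_E p*` (the various normalisations `log_E(p) = 0`, `log_E(ϖ) = 0`, … differ only off
the units). [folklore] -/
theorem logOnePlusNormEq_of_eqOn {logE : E → E}
    (h : EqOn logE logSeries (closedBall (1 : E) ‖((pStar p : ℕ) : E)‖)) :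
    LogOnePlusNormEq E logE ((pStar p : ℕ) : E) := by
  intro x hx hxp
  have hmem : 1 + x ∈ closedBall (1 : E) ‖((pStar p : ℕ) : E)‖ := by
    rw [mem_closedBall, dist_eq_norm, add_sub_cancel_left]; exact hxp
  rw [h hmem, norm_logSeries_one_add p E hx hxp]

include instU instC in
/-- **Lemma 9.8.2.7 at the standard model** `PadicLogOnUnits.ofUnitLog p E` of [AbsTopIII] Def. 5.4 (iii) (abc-iut-L3-t11;
the structure abc-iut-E-t21's `ATS3.LocalBKDatum` extends): for ITS `log` and ITS `pstar`. [folklore] -/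
theorem logOnePlusNormEq_ofUnitLog :
    LogOnePlusNormEq E (PadicLogOnUnits.ofUnitLog p E).log (PadicLogOnUnits.ofUnitLog p E).pstar := by
  rw [PadicLogOnUnits.ofUnitLog_log, PadicLogOnUnits.ofUnitLog_pstar, ← pStar_cast_eq p E]
  exact logOnePlusNormEq_unitLog p E

end Lemma9827

/-! ## 3. Consistency with the `ℚ_p` discharge (p430076) -/

section Padic

variable (p : ℕ) [hp : Fact p.Prime]

/-- The logarithmic series of `PAdicHeights` (abc-iut's Iwasawa branch on `ℚ_p`) IS abc-iut-S1's `logSeries` at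
`E = ℚ_p` (same `tsum`). [folklore] -/
theorem padicLogSeries_eq_logSeries (y : ℚ_[p]) : padicLogSeries p y = logSeries y := rfl

/-- On principal units of `ℚ_p` the Iwasawa logarithm `padicLog` (normalised by `log_p(p) = 0`) and the unit logarithm
`unitLog` coincide (both are the series); in particular the Iwasawa branch agrees with the series on `1 + p*·ℤ_p`, so
p430076's `logOnePlusNormEq_padic` is the `E = ℚ_p` instance of `logOnePlusNormEq_of_eqOn` / `logOnePlusNormEq_unitLog`.
[folklore] -/
theorem padicLog_eq_unitLog_of_isPrincipal {y : ℚ_[p]} (hy : IsPrincipal y) : padicLog p y = unitLog y := by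
  rw [padicLog_eq_padicLogSeries hy, unitLog_of_isPrincipal p hy, padicLogSeries_eq_logSeries]

/-- The Iwasawa branch `padicLog` agrees with the series on `1 + p*·ℤ_p` — the hypothesis of `logOnePlusNormEq_of_eqOn` at
`E = ℚ_p` (whose conclusion is p430076's `logOnePlusNormEq_padic`, not restated). [folklore] -/
theorem padicLog_eqOn_logSeries_closedBall :
    EqOn (padicLog p) logSeries (closedBall (1 : ℚ_[p]) ‖((pStar p : ℕ) : ℚ_[p])‖) := fun y hy => by
  rw [mem_closedBall, dist_eq_norm, norm_sub_rev] at hy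
  exact padicLog_eq_padicLogSeries (hy.trans_lt (norm_pStar_cast_lt_one p ℚ_[p]))

end Padic

/-! ## 4. Remark 9.8.2.3 and (9.9.2)–(9.9.3) DERIVED -/

section Rmk9823

variable (p : ℕ) [hp : Fact p.Prime]
variable (E : Type) [NontriviallyNormedField E] [instE : NormedAlgebra ℚ_[p] E] [instU : IsUltrametricDist E]
  [instC : CompleteSpace E]

include instE instU instC in
/-- **Rmk. 9.8.2.3, first sentence, DERIVED in every `p`-adic field** (p.117 l.63–72: «by Lemma 9.8.2.7,
`|log_p(1 + p*_w)|_{L′_w} = |p*_w|` for all `w ∈ 𝕍_{L′}`»). [claim: Joshi2024ATS3, status: disputed] -/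
theorem norm_unitLog_one_add_pStar :
    ‖unitLog (1 + ((pStar p : ℕ) : E))‖ = ‖((pStar p : ℕ) : E)‖ :=
  norm_unitLog_one_add p E (pStar_cast_ne_zero p E) le_rfl

include instE instU instC in
/-- **(9.9.2)–(9.9.3) DERIVED in every `p`-adic field** (p.120 l.106 – p.121 l.36: «|log_{L′_w}(1 + p*·q^{1/2ℓ}_{w;j})/p*|
… By Lemma 9.8.2.7 one has … = |q^{1/2ℓ}_{w;j}|»): for `q ∈ 𝒪_E`, `‖p*⁻¹·log_E(1 + p*·q)‖ = ‖q‖` (`q = 0` included: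
both sides vanish). [claim: Joshi2024ATS3, status: disputed] -/
theorem norm_pStar_inv_mul_unitLog_one_add_mul {q : E} (hq : ‖q‖ ≤ 1) :
    ‖(((pStar p : ℕ) : E))⁻¹ * unitLog (1 + ((pStar p : ℕ) : E) * q)‖ = ‖q‖ := by
  have hp0 : ((pStar p : ℕ) : E) ≠ 0 := pStar_cast_ne_zero p E
  have hnp : 0 < ‖((pStar p : ℕ) : E)‖ := norm_pos_iff.mpr hp0
  by_cases hq0 : q = 0
  · subst hq0
    rw [mul_zero, add_zero, unitLog_one p, mul_zero, norm_zero]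
  · have hx : ((pStar p : ℕ) : E) * q ≠ 0 := mul_ne_zero hp0 hq0
    have hxp : ‖((pStar p : ℕ) : E) * q‖ ≤ ‖((pStar p : ℕ) : E)‖ := by
      rw [norm_mul]; exact mul_le_of_le_one_right hnp.le hq
    rw [norm_mul, norm_inv, norm_unitLog_one_add p E hx hxp, norm_mul, ← mul_assoc, inv_mul_cancel₀ hnp.ne',
      one_mul]

include instE instU instC in
/-- **Rmk. 9.8.2.3, second sentence, DERIVED**: «So `log_BK(1 + p*)` contributes an element of unit norm» — with
`log_BK = p*⁻¹·log_p` on `1 + p*·𝒪` ((9.7.2.2) p.110 l.55–75): `‖p*⁻¹·log_E(1 + p*)‖ = 1`. [claim: Joshi2024ATS3, status: disputed] -/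
theorem norm_pStar_inv_mul_unitLog_one_add_pStar :
    ‖(((pStar p : ℕ) : E))⁻¹ * unitLog (1 + ((pStar p : ℕ) : E))‖ = 1 := by
  have h := norm_pStar_inv_mul_unitLog_one_add_mul p E (q := (1 : E)) (by rw [norm_one])
  rwa [mul_one, norm_one] at h

end Rmk9823

/-! ## 5. Remark 9.8.2.3 at abc-iut-E-t21's local Bloch–Kato datum -/

namespace LocalBKDatum

variable {p : ℕ} [hp : Fact p.Prime]
variable {E : Type} [NontriviallyNormedField E] [instE : NormedAlgebra ℚ_[p] E] [instU : IsUltrametricDist E]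
  [instC : CompleteSpace E] {H1Z H1Q : Type} (C : LocalBKDatum E H1Z H1Q)

include instE instU instC in
/-- At a local Bloch–Kato datum (abc-iut-E-t21, p429108) whose `p`-adic logarithm on units is the STANDARD MODEL
`PadicLogOnUnits.ofUnitLog p E` and under HIS reading predicate `LogBKPrincipalUnits` ((9.7.2.2): `log_BK(ξ) =
p*⁻¹·log_p(ξ)` for `ξ ≡ 1 mod p*`), the Bloch–Kato logarithm of the Kummer class of `ξ = 1 + p*·q`, `q ∈ 𝒪_E`, has norm
`‖q‖` — the computation (9.9.2)–(9.9.3) «By Lemma 9.8.2.7» for `ξ_{w,j} = 1 + p*·q^{1/2ℓ}_{w;j}`. The membership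
`he` (the class lies in `H¹_e`) is what HIS `PrincipalUnitsCrystalline` supplies; it is taken as an argument.
[claim: Joshi2024ATS3, status: disputed] -/
theorem norm_logBK_one_add_pstar_mul (hlog : C.toPadicLogOnUnits = PadicLogOnUnits.ofUnitLog p E)
    (hBK : C.LogBKPrincipalUnits) {q : E} (hq : ‖q‖ ≤ 1) (he : C.toQ (C.kummer (1 + C.pstar * q)) ∈ C.H1e) :
    ‖C.logBK ⟨C.toQ (C.kummer (1 + C.pstar * q)), he⟩‖ = ‖q‖ := by
  have hps : C.pstar = ((pStar p : ℕ) : E) := by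
    rw [show C.pstar = C.toPadicLogOnUnits.pstar from rfl, hlog, PadicLogOnUnits.ofUnitLog_pstar, pStar_cast_eq]
  have hlg : C.log = unitLog := by
    rw [show C.log = C.toPadicLogOnUnits.log from rfl, hlog, PadicLogOnUnits.ofUnitLog_log]
  have hmem : 1 + C.pstar * q ∈ closedBall (1 : E) ‖C.pstar‖ := by
    rw [mem_closedBall, dist_eq_norm, add_sub_cancel_left, norm_mul]
    exact mul_le_of_le_one_right (norm_nonneg _) hq
  rw [hBK _ hmem he, hlg, hps]
  exact norm_pStar_inv_mul_unitLog_one_add_mul p E hq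

include instE instU instC in
/-- **Rmk. 9.8.2.3 at the datum**: the Bloch–Kato logarithm of the Kummer class of the unit `1 + p*` has norm `1` —
«`log_BK(1 + p*)` contributes an element of unit norm» (p.117 l.73–80), for the standard-model logarithm and under the
(9.7.2.2) reading. [claim: Joshi2024ATS3, status: disputed] -/
theorem norm_logBK_one_add_pstar (hlog : C.toPadicLogOnUnits = PadicLogOnUnits.ofUnitLog p E)
    (hBK : C.LogBKPrincipalUnits) (he : C.toQ (C.kummer (1 + C.pstar)) ∈ C.H1e) :
    ‖C.logBK ⟨C.toQ (C.kummer (1 + C.pstar)), he⟩‖ = 1 := by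
  have key : ∀ (u : E), u = 1 + C.pstar * 1 → ∀ (hu : C.toQ (C.kummer u) ∈ C.H1e),
      ‖C.logBK ⟨C.toQ (C.kummer u), hu⟩‖ = 1 := by
    rintro u rfl hu
    rw [C.norm_logBK_one_add_pstar_mul hlog hBK (q := (1 : E)) (by rw [norm_one]) hu, norm_one]
  exact key _ (by rw [mul_one]) he

end LocalBKDatum

end Summit.ABC.IUTFork.Joshi.ATS3

/-! ## 6. SUPPLIER DISCHARGE of abc-iut-E-t23's input `ScalingDatum.NormLogBK` -/

namespace Summit.ABC.IUTFork.Joshi.LogVol.ScalingDatum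

open Literature.IUT.LogVolume Summit.ABC.IUTFork.Joshi.ATS3

variable {p : ℕ} [hp : Fact p.Prime]
variable {lstar : ℕ} {E : Fin lstar → Type} [instN : ∀ i, NontriviallyNormedField (E i)]
  [instE : ∀ i, NormedAlgebra ℚ_[p] (E i)] [instU : ∀ i, IsUltrametricDist (E i)] [instC : ∀ i, CompleteSpace (E i)]
  [∀ i, MeasurableSpace (E i)] {X : Type} [MeasurableSpace X] (Dw : ScalingDatum lstar E X)

include instE instU instC in
/-- **E-t23's `NormLogBK` ((9.9.2)–(9.9.3)) SUPPLIED** at every scaling datum (p429684) whose fields `L′_{w,j}` are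
`p`-adic fields (`p = p_w`) READ WITH THEIR NORMS (`|−|_{L′_{w,j}} = ‖−‖`) and whose exhibited element is READ as
(9.7.2.2) prescribes, `τ_j = log_BK(ξ_{w,j}) = p*⁻¹·log_{L′_{w,j}}(1 + p*·q^{1/2ℓ}_{w;j})` with `q^{1/2ℓ}_{w;j} ∈ 𝒪`
(print p.120 l.106–130): then `|τ_j| = |q^{1/2ℓ}_{w;j}|` for every `j` — «By Lemma 9.8.2.7» (p.121 l.22–36), now a
theorem (`norm_pStar_inv_mul_unitLog_one_add_mul`). The reading hypotheses are the dictionary content; the analytic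
step is proved. [claim: Joshi2024ATS3, status: disputed] -/
theorem normLogBK_of_logReading (habs : ∀ i (x : E i), (Dw.D i).abs x = ‖x‖)
    (hτ : ∀ i, Dw.τ i = (((pStar p : ℕ) : E i))⁻¹ * unitLog (1 + ((pStar p : ℕ) : E i) * Dw.qrt i))
    (hq : ∀ i, ‖Dw.qrt i‖ ≤ 1) : Dw.NormLogBK := by
  intro i
  rw [habs, habs, hτ i]
  exact norm_pStar_inv_mul_unitLog_one_add_mul p (E i) (hq i)

include instE instU instC in
/-- The same with the integrality `q^{1/2ℓ}_{w;j} ∈ 𝒪` DERIVED from HIS (9.9.4) `RootScaling e` for any exponent law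
`e ≥ 0` (`|q^{1/2ℓ}_{w;j}| = |q_w^{1/2ℓ}|^{e(j)} ≤ 1` since `|q_w^{1/2ℓ}| < 1`): both print's `scalingExponent`
(`j²/ℓ*²`, E-t4) and the literal `j²` (T-07) qualify. [claim: Joshi2024ATS3, status: disputed] -/
theorem normLogBK_of_logReading_of_rootScaling (habs : ∀ i (x : E i), (Dw.D i).abs x = ‖x‖)
    (hτ : ∀ i, Dw.τ i = (((pStar p : ℕ) : E i))⁻¹ * unitLog (1 + ((pStar p : ℕ) : E i) * Dw.qrt i))
    {e : Fin lstar → ℝ} (he : ∀ i, 0 ≤ e i) (hsc : Dw.RootScaling e) : Dw.NormLogBK := by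
  refine Dw.normLogBK_of_logReading habs hτ fun i => ?_
  rw [← habs, hsc i]
  exact Real.rpow_le_one Dw.qroot_pos.le Dw.qroot_lt_one.le (he i)

include instE instU instC in
/-- Hence, under the same READING, E-t4's `ValuationScaling` for the projection needs only (9.9.4) with print's exponent
law (E-t23's `valuationScaling_of` with its first input discharged). [claim: Joshi2024ATS3, status: disputed] -/
theorem valuationScaling_of_logReading (habs : ∀ i (x : E i), (Dw.D i).abs x = ‖x‖)
    (hτ : ∀ i, Dw.τ i = (((pStar p : ℕ) : E i))⁻¹ * unitLog (1 + ((pStar p : ℕ) : E i) * Dw.qrt i))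
    (hsc : Dw.RootScaling (ATS3.LocusDatum.scalingExponent lstar)) : Dw.toLocusDatum.ValuationScaling :=
  Dw.valuationScaling_of
    (Dw.normLogBK_of_logReading_of_rootScaling habs hτ (ATS3.LocusDatum.scalingExponent_nonneg) hsc) hsc

include instE instU instC in
/-- … and Thm. 9.9.1 at `w` for the projection rests on the READING + `RootScaling scalingExponent` + `CrossNorm`
(E-t23's `fundamentalEstimateSup_of_inputs`, input `NormLogBK` discharged). [claim: Joshi2024ATS3, status: disputed] -/
theorem fundamentalEstimateSup_of_logReading (habs : ∀ i (x : E i), (Dw.D i).abs x = ‖x‖)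
    (hτ : ∀ i, Dw.τ i = (((pStar p : ℕ) : E i))⁻¹ * unitLog (1 + ((pStar p : ℕ) : E i) * Dw.qrt i))
    (hsc : Dw.RootScaling (ATS3.LocusDatum.scalingExponent lstar)) (hcr : Dw.CrossNorm) :
    Dw.toLocusDatum.FundamentalEstimateSup :=
  Dw.fundamentalEstimateSup_of_inputs
    (Dw.normLogBK_of_logReading_of_rootScaling habs hτ (ATS3.LocusDatum.scalingExponent_nonneg) hsc) hsc hcr

include instE instU instC in
/-- … and Cor. 9.11.1.1 at `w` for the projection rests on the READING + `RootScaling scalingExponent` + the sign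
convention (E-t23's `cor91111_of_inputs`, input `NormLogBK` discharged). [claim: Joshi2024ATS3, status: disputed] -/
theorem cor91111_of_logReading (habs : ∀ i (x : E i), (Dw.D i).abs x = ‖x‖)
    (hτ : ∀ i, Dw.τ i = (((pStar p : ℕ) : E i))⁻¹ * unitLog (1 + ((pStar p : ℕ) : E i) * Dw.qrt i))
    (hsc : Dw.RootScaling (ATS3.LocusDatum.scalingExponent lstar)) (hsg : Dw.toLocusDatum.LogVolNonpos) :
    Dw.toLocusDatum.Cor91111 :=
  Dw.cor91111_of_inputs
    (Dw.normLogBK_of_logReading_of_rootScaling habs hτ (ATS3.LocusDatum.scalingExponent_nonneg) hsc) hsc hsg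

end Summit.ABC.IUTFork.Joshi.LogVol.ScalingDatum

end
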